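import Summits.Ventures.CertifiedArithmetic.LowPrec.SROptimalBudget
import HarnessLib

/-!
# Stochastic rounding in low-precision formats LIX — minimum-VARIANCE rounding under a bias budget:
# the exact solution of the constrained problem posed in [XiaEtAl2020, §4.2.4]

HONEST FRAMING: certified error envelopes and provably optimal rounding/accumulation schemes for
low-precision formats under stated cost models; every table by two implementations; no hardware or
vendor claims.

[XiaEtAl2020, §4, (4.1)–(4.7)] pose, for a two-point randomised rounding with free down-probability
`p`, the multi-objective problem "minimise the variance `V(p) = δ²p(1−p)` and the bias `|B(p)|`", and
in §4.2.4 the constrained instance "minimise `V` subject to `|B| ≤ B_max`", which they solve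
numerically (particle-swarm optimisation of a penalised scalarisation; distribution D2).  File LVII
solved the MEAN-SQUARE-ERROR version in closed form over all laws on any finite value set.  This file
solves the VARIANCE version exactly as posed, again over ALL randomised roundings into `F` (any finite
`F`, non-uniform cells, saturating ends — not only two-point laws on a uniform grid):

* VALUE (`law_var_ge_budgetVar`, `step_optMean_var`): for `a` in the hull, `d = ⌊a⌋ ≤ a ≤ u = ⌈a⌉`,
  `v = v_F(a)`, `s = d + u − 2a`, `ρ = ρ(a)` the distance to the nearer neighbour and `b ≥ 0`,
  `min { Var(w) : w a law on F, |mean(w) − a| ≤ b } = max(0, v − b|s| − b²) = budgetMSE(a,b) − min(b,ρ)²`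
  (`budgetVar`, `budgetVar_eq`), i.e. `(ρ − b)(ρ + b + |s|)` for `b ≤ ρ` and `0` for `b ≥ ρ`.
* MINIMISER: the same law as for the MSE problem — stochastic rounding of the input shifted by
  `min(b, ρ)` toward its NEARER neighbour (`optMean` of file LVII); so the variance- and the
  MSE-optimal roundings under a bias budget coincide (for a fixed mean they differ by the constant
  `bias²`, `law_var_eq`), and both spend the whole budget up to `ρ`.
* REGIMES: `b = 0` gives `v` (SR: the least variance of an unbiased rounding, file LV);
  `0 < budgetVar` for `b < ρ` — no rounding with bias below round-to-nearest's error is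
  deterministic (`budgetVar_pos`); `b ≥ ρ` gives `0` (round to nearest).
* The source's variance formula (4.4), `V = δ²p(1−p)`, for a general cell: `twoPoint_var`.
* FP4 witness (kernel): E2M1, `a = 9/8`: `b = 0 ↦ 3/64`, `b = 1/16 ↦ 7/256` (= variance of
  `SR(17/16)`: up-probability `1/8`, `(1/8)(7/8)(1/2)²`), `b = 1/8 ↦ 0`.
Certificates: `certs/sr/gen12/budget/` extended by `BUD_var_{A,B}.txt` (A closed form, B exact LP).
-/

namespace Summit.Ventures.CertifiedArithmetic.LowPrec.SR

open Literature.ComputerArithmetic.ConnollyHighamMary2021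
open Finset

section Generic

variable {K : Type*} [Field K] [LinearOrder K] [IsStrictOrderedRing K]

/-- The variance-budget value function `max(0, v_F(a) − b|⌊a⌋ + ⌈a⌉ − 2a| − b²)`. -/
def budgetVar (F : Finset K) (a b : K) : K :=
  max 0 (srVar F a - b * |dn F a + up F a - 2 * a| - b ^ 2)

omit [LinearOrder K] [IsStrictOrderedRing K] in
/-- Variance = MSE about any centre `a` minus bias²: `Σ w(y)(y − m)² = Σ w(y)(y − a)² − (m − a)²`
for a law of total mass `1` with mean `m`. -/
theorem law_var_eq {F : Finset K} {w : K → K} (h1 : ∑ y ∈ F, w y = 1) (a : K) :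
    ∑ y ∈ F, w y * (y - ∑ z ∈ F, w z * z) ^ 2
      = ∑ y ∈ F, w y * (y - a) ^ 2 - ((∑ z ∈ F, w z * z) - a) ^ 2 := by
  set m := ∑ z ∈ F, w z * z with hm
  have e : ∀ y, w y * (y - m) ^ 2
      = w y * (y - a) ^ 2 + (-2 * (m - a)) * (w y * y) + (m ^ 2 - a ^ 2) * w y := fun y => by ring
  simp_rw [e, Finset.sum_add_distrib, ← Finset.mul_sum, h1, ← hm]
  ring

omit [LinearOrder K] [IsStrictOrderedRing K] in
/-- The source's (4.4) on a general cell: the two-point law `u` w.p. `π`, `d` w.p. `1 − π` has variance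
`π(1 − π)(u − d)²` about its mean. [cite: XiaEtAl2020, (4.4)] -/
theorem twoPoint_var (π d u : K) :
    π * (u - (π * u + (1 - π) * d)) ^ 2 + (1 - π) * (d - (π * u + (1 - π) * d)) ^ 2
      = π * (1 - π) * (u - d) ^ 2 := by
  ring

/-- Closed form of the value: `budgetVar F a b = budgetMSE F a b − min(b, ρ(a))²` (`a` in the hull,
`0 ≤ b`); in particular `= (ρ − b)(ρ + b + |s|)` for `b ≤ ρ` and `= 0` for `ρ ≤ b`. -/
theorem budgetVar_eq {F : Finset K} {a b : K} (ha : InHull F a) (hb : 0 ≤ b) :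
    budgetVar F a b = budgetMSE F a b - min b (nearDist F a) ^ 2 := by
  have hρ := srVar_sub_nearDist_mul ha
  have hs := abs_nonneg (dn F a + up F a - 2 * a)
  unfold budgetVar
  rcases le_total b (nearDist F a) with h | h
  · rw [budgetMSE_of_le_nearDist h, min_eq_left h]
    apply max_eq_right
    nlinarith
  · rw [budgetMSE_of_nearDist_le ha h, min_eq_right h]
    rw [sub_self]
    apply max_eq_left
    nlinarith [nearDist_nonneg ha]

/-- `b = 0`: the least variance of an UNBIASED rounding is `v_F(a)` (attained by SR, file LV). -/
theorem budgetVar_zero {F : Finset K} {a : K} (ha : InHull F a) : budgetVar F a 0 = srVar F a := by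
  rw [budgetVar_eq ha le_rfl, budgetMSE_zero ha]
  simp [min_eq_left (nearDist_nonneg ha)]

/-- `ρ(a) ≤ b`: zero variance is feasible (round to nearest). -/
theorem budgetVar_of_nearDist_le {F : Finset K} {a b : K} (ha : InHull F a)
    (h : nearDist F a ≤ b) : budgetVar F a b = 0 := by
  rw [budgetVar_eq ha ((nearDist_nonneg ha).trans h), budgetMSE_of_nearDist_le ha h, min_eq_right h,
    sub_self]

/-- `0 ≤ b < ρ(a)`: every rounding within the budget is genuinely random — the least variance is
`(ρ − b)(ρ + b + |s|) > 0`. -/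
theorem budgetVar_pos {F : Finset K} {a b : K} (ha : InHull F a) (hb : 0 ≤ b)
    (h : b < nearDist F a) : 0 < budgetVar F a b := by
  rw [budgetVar_eq ha hb, budgetMSE_of_le_nearDist h.le, min_eq_left h.le]
  have hρ := srVar_sub_nearDist_mul ha
  have hs := abs_nonneg (dn F a + up F a - 2 * a)
  nlinarith

/-- **LOWER BOUND over all randomised roundings.**  Every law `w ≥ 0`, `Σ w = 1` on `F` whose mean
is within `b` of the in-hull input `a` has variance `≥ budgetVar F a b`. [new; the problem is
XiaEtAl2020 §4.2.4] -/
theorem law_var_ge_budgetVar {F : Finset K} {a : K} (ha : InHull F a) {w : K → K}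
    (hw : ∀ y ∈ F, 0 ≤ w y) (h1 : ∑ y ∈ F, w y = 1) {b : K}
    (hb : |(∑ y ∈ F, w y * y) - a| ≤ b) :
    budgetVar F a b ≤ ∑ y ∈ F, w y * (y - ∑ z ∈ F, w z * z) ^ 2 := by
  rw [law_var_eq h1 a]
  set m := ∑ z ∈ F, w z * z with hm
  have hf := law_sq_ge_frontier ha hw h1
  rw [← hm] at hf
  have hvar0 : 0 ≤ ∑ y ∈ F, w y * (y - a) ^ 2 - (m - a) ^ 2 := by
    rw [← law_var_eq h1 a]
    exact Finset.sum_nonneg fun y hy => mul_nonneg (hw y hy) (sq_nonneg _)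
  apply max_le hvar0
  have h2 : -(|m - a| * |dn F a + up F a - 2 * a|) ≤ (m - a) * (dn F a + up F a - 2 * a) := by
    rw [← abs_mul]; exact neg_abs_le _
  have h3 : |m - a| * |dn F a + up F a - 2 * a| ≤ b * |dn F a + up F a - 2 * a| :=
    mul_le_mul_of_nonneg_right hb (abs_nonneg _)
  have h4 : (m - a) ^ 2 ≤ b ^ 2 := by
    rw [← sq_abs]; exact pow_le_pow_left₀ (abs_nonneg _) hb 2
  linarith

/-- Second moment of one SR step about any centre: `E(SR(c) − e)² = v_F(c̄) + (c̄ − e)²`. -/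
theorem step_sq_sub (F : Finset K) (c e : K) :
    step F c (fun z => (z - e) ^ 2) = srVar F (clamp F c) + (clamp F c - e) ^ 2 := by
  have h := step_sq_add F c (-e)
  simp only [← sub_eq_add_neg] at h
  exact h

/-- **ATTAINMENT by the MSE-optimal law.**  Stochastic rounding of the shifted input
`m⋆ = optMean F a b` (file LVII) has bias `≤ b` and variance exactly `budgetVar F a b`. [new] -/
theorem step_optMean_var {F : Finset K} {a b : K} (ha : InHull F a) (hb : 0 ≤ b) :
    |step F (optMean F a b) (fun z => z) - a| ≤ b ∧
    step F (optMean F a b) (fun z => (z - optMean F a b) ^ 2) = budgetVar F a b := by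
  obtain ⟨hbias, hmse⟩ := step_optMean_sq ha hb
  refine ⟨hbias, ?_⟩
  obtain ⟨h1, h2⟩ := optMean_mem_cell ha hb
  have hcl : clamp F (optMean F a b) = optMean F a b := clamp_eq_self (inHull_of_mem_cell ha h1 h2)
  rw [step_sq_sub, hcl] at hmse ⊢
  rw [sub_self, budgetVar_eq ha hb, ← hmse, ← abs_optMean_sub ha hb, sq_abs]
  ring

/-- **The variance-budget problem solved** (packaged): the SR law at `m⋆` is a probability vector on
`F` with bias within budget whose variance is the minimum over all feasible laws. -/
theorem var_budget_optimal {F : Finset K} {a b : K} (ha : InHull F a) (hb : 0 ≤ b) :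
    (∀ w : K → K, (∀ y ∈ F, 0 ≤ w y) → ∑ y ∈ F, w y = 1 → |(∑ y ∈ F, w y * y) - a| ≤ b →
        budgetVar F a b ≤ ∑ y ∈ F, w y * (y - ∑ z ∈ F, w z * z) ^ 2) ∧
    (∀ y, 0 ≤ srLaw F (optMean F a b) y) ∧ ∑ y ∈ F, srLaw F (optMean F a b) y = 1 ∧
    |(∑ y ∈ F, srLaw F (optMean F a b) y * y) - a| ≤ b ∧
    ∑ y ∈ F, srLaw F (optMean F a b) y * (y - ∑ z ∈ F, srLaw F (optMean F a b) z * z) ^ 2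
      = budgetVar F a b := by
  have hF : F.Nonempty := by obtain ⟨⟨z, hz, -⟩, -⟩ := ha; exact ⟨z, hz⟩
  obtain ⟨hbias, hvar⟩ := step_optMean_var ha hb
  obtain ⟨h1, h2⟩ := optMean_mem_cell ha hb
  have hmean : ∑ y ∈ F, srLaw F (optMean F a b) y * y = optMean F a b := by
    rw [sum_srLaw_mul hF]; exact step_shift_id ha h1 h2
  refine ⟨fun w hw hw1 hwb => law_var_ge_budgetVar ha hw hw1 hwb, srLaw_nonneg F _,
    sum_srLaw hF _, ?_, ?_⟩
  · rw [hmean, abs_optMean_sub ha hb]; exact min_le_left _ _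
  · rw [hmean, sum_srLaw_mul hF]; exact hvar

/-- MSE- and variance-optimal roundings under a bias budget coincide and both spend exactly
`min(b, ρ)`: the common minimiser's variance and MSE differ by that bias squared. -/
theorem budgetMSE_sub_budgetVar {F : Finset K} {a b : K} (ha : InHull F a) (hb : 0 ≤ b) :
    budgetMSE F a b - budgetVar F a b = min b (nearDist F a) ^ 2 := by
  rw [budgetVar_eq ha hb]; ring

end Generic

/-! ### FP4 (E2M1) witness, kernel-checked -/

namespace FP4

/-- E2M1, `a = 9/8` (cell `[1, 3/2]`, `v = 3/64`, `ρ = 1/8`, `|s| = 1/4`): `budgetVar 0 = 3/64` (SR);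
`b = 1/16`: `7/256`, the variance of `SR(17/16)` (up-probability `1/8`); `b = 1/8`: `0` (RN). -/
theorem fp4_budgetVar_witness :
    budgetVar e2m1 (9/8 : ℚ) 0 = 3/64 ∧ budgetVar e2m1 (9/8 : ℚ) (1/16) = 7/256
    ∧ step e2m1 (17/16 : ℚ) (fun z => (z - 17/16) ^ 2) = 7/256
    ∧ optMean e2m1 (9/8 : ℚ) (1/16) = 17/16 ∧ budgetVar e2m1 (9/8 : ℚ) (1/8) = 0 := by
  refine ⟨?_, ?_, ?_, ?_, ?_⟩ <;> decide +kernel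

end FP4

end Summit.Ventures.CertifiedArithmetic.LowPrec.SR
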